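import Summits.BirchSwinnertonDyer.BirchSwinnertonDyer.Theses.EdixhovenFibreFiveSeven
import Summits.BirchSwinnertonDyer.BirchSwinnertonDyer.Theorems.AdditiveKolyvaginRoadManinFrameResidueProperRTameTwistFull
import HarnessLib

/-!
# Route `EdixhovenFibreFiveSeven`, crux TDS11 `TwistDegreeStepOrdinary` (stmt-BirchSwinnertonDyer-22228):
# CONDITIONAL by-name closer — TDS11 granted ONE named Literature fact (Kato's zeta elements read in
# Néron units at an additive prime; `--supports`, nothing is closed)

Cell `pub/bsd-wall` (D-0145 line `route-BirchSwinnertonDyer-EdixhovenFibreFiveSeven`), seat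
`bsd-line-edix-p3` (prover seat 3/3). THEOREMS ONLY (no definition, no named fact, no `sorry`). BSD
is not proved by this file and the item is NOT closed by it: both theorems take a cite-only named
fact as a hypothesis (`proof.conditional`).

TDS11 is the registered stub `stub_twistDegreeStep` of AKR's line
`Cruxes/ManinFrameResidueProperR/Lines/birth.lean` filed as an item of this route (binders verbatim:
`p ≥ 11`, `Addv`, `Irr`, residue clause, all conductor-level degrees of the class divisible by `p`;
conclusion: for every unstarred (G)-ordinary globally minimal member `V ∼ W` and every globally
minimal model `W♭` of `V ⊗ χ_{p*}`, some conductor-level datum of `V` has strictly fewer factors `p`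
in its modular degree than every conductor-level datum of `W♭` — Edixhoven 1991 §4 "case 2"). Seat
`bsd-wall-manin-p1` g3 proved exactly this stub GRANTED the single Literature fact
`kato_neron_isIntegral_twistedSymbolSum_of_additive` (the all-characters tame-twist lever:
`ManinFrameResidueProperRTameTwist.stub_twistDegreeStep_of_kato`, file
`AdditiveKolyvaginRoadManinFrameResidueProperRTameTwistFull`). This file re-types that result as the
route decl BY NAME:

* `twistDegreeStepOrdinary_of_kato : kato_neron_isIntegral_twistedSymbolSum_of_additive →
  TwistDegreeStepOrdinary`;
* `twistDegreeStepOrdinary_of_kato_five_le : F″ → TwistDegreeStepOrdinary` — the `p ≥ 5` reading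
  F″ (`kato_neron_isIntegral_twistedSymbolSum_of_additive_five_le`, the fact seat edix-p1 reduces
  the sibling crux K★ to, `starredOptimalManinUnitFiveSeven_of_kato`) specialises to the `p > 7`
  reading F by its left disjunct (the named version is seat edix-p1's
  `KatoLever.kato_neron_of_five_le`; inlined here as a term), so K★ and TDS11 hinge on the SAME
  single named fact.

HONEST STATUS: the fact is a DERIVED reading of Kato, Astérisque 295 (2004) (8.1.3)/Thm 9.7/Thm 6.6(1)
with Kim–Nakamura 2020 Cor. 2.4 ⟸ Kosters–Pannekoek Thm 1 (referee flag in its docstring; size XL,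
no `_holds`); TDS11 stays OPEN on the ledger (conditional-result). Unconditionally TDS11 is Manin's
conjecture (`p`-part) for the optimal curves of Edixhoven's exceptional locus at `p ≥ 11`, open in
print (Česnavičius–Neururer–Saha 2024 §1).
[cite: EdixhovenManin1991, Thm. 3 and §4 (cases 1/2)] [cite: Kato2004Asterisque, (8.1.3) (p. 180), Thm. 9.7 (p. 189)]
[cite: KimNakamura2020, Cor. 2.4] [cite: CesnaviciusNeururerSaha2023, §1]
-/

set_option autoImplicit false
-- single-conjunct summit: `Summit.BirchSwinnertonDyer.BirchSwinnertonDyer.…` repeats the name by design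
set_option linter.dupNamespace false

noncomputable section

open WeierstrassCurve Literature.NumberTheory.EllipticCurves
  Literature.NumberTheory.EllipticCurves.ModularForms
  Literature.NumberTheory.EllipticCurves.Rank1Residual
  Summit.BirchSwinnertonDyer.BirchSwinnertonDyer.Theorems
  Summit.BirchSwinnertonDyer.BirchSwinnertonDyer.Theses.EdixhovenFibreFiveSeven

namespace Summit.BirchSwinnertonDyer.BirchSwinnertonDyer.Theorems.EdixhovenFibreFiveSevenTwistDegreeStepOrdinary

/-- **TDS11 `TwistDegreeStepOrdinary` (stmt-BirchSwinnertonDyer-22228) GRANTED the Kato fact** —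
CONDITIONAL by-name closer: the route decl from `kato_neron_isIntegral_twistedSymbolSum_of_additive`
by seat manin-p1 g3's `ManinFrameResidueProperRTameTwist.stub_twistDegreeStep_of_kato` (the AKR stub
with the SAME binders: the tame-twist lever gives, at every frame with `p ≥ 11` additive and `E[p]`
irreducible, a globally minimal member with a Manin-unit conductor-level datum, and the translation
`ManinFrameResidueProperTwistDegree.twistDegreeStep_of_exists_member_not_dvd_c` turns it into the
twist-degree inequality; the residue and degree clauses are idle). The item stays open: the fact
is not discharged (XL). [cite: EdixhovenManin1991, §4 (cases 1/2)]
[cite: Kato2004Asterisque, (8.1.3) (p. 180), Thm. 9.7 (p. 189)] [cite: KimNakamura2020, Cor. 2.4] -/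
theorem twistDegreeStepOrdinary_of_kato (hK : kato_neron_isIntegral_twistedSymbolSum_of_additive) :
    Summit.BirchSwinnertonDyer.BirchSwinnertonDyer.Theses.EdixhovenFibreFiveSeven.TwistDegreeStepOrdinary := by
  intro hnf W _ _ p _ _ hp11 hadd hirr hres hall V _ _ _ Wf _ _ _ C hisoV hG hV4 hC
  exact ManinFrameResidueProperRTameTwist.stub_twistDegreeStep_of_kato hK hnf W hp11 hadd hirr hres
    hall V Wf C hisoV hG hV4 hC

/-- **TDS11 GRANTED the `p ≥ 5` reading F″** (the single named fact seat edix-p1 reduces the sibling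
crux K★ `StarredOptimalManinUnitFiveSeven` to): `F″ → TwistDegreeStepOrdinary` — at `7 < p` the
extra clause `7 < p ∨ (gcd(ord_m p, p − 1) = 1 ∧ V(ℚ_p)[p] = 0)` of F″ holds by its left disjunct and
`5 ≤ p`, so F″ specialises to F (pure logic on the two statement-only facts; the named version is
seat edix-p1's `KatoLever.kato_neron_of_five_le`), then `twistDegreeStepOrdinary_of_kato`.
So two of the three Manin cruxes of the route hinge on ONE named fact. CONDITIONAL; nothing closed.
[cite: Kato2004Asterisque, (8.1.3) (p. 180), Thm. 9.7 (p. 189)] [cite: KostersPannekoek2017, Thm. 1] -/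
theorem twistDegreeStepOrdinary_of_kato_five_le
    (hK : kato_neron_isIntegral_twistedSymbolSum_of_additive_five_le) :
    Summit.BirchSwinnertonDyer.BirchSwinnertonDyer.Theses.EdixhovenFibreFiveSeven.TwistDegreeStepOrdinary :=
  twistDegreeStepOrdinary_of_kato fun V _ _ _ _ f hf p _ hp7 hng hnm hirr m _ hm χ hχ hχ1 hord ϖ r ↦
    hK V f hf p (by omega) hng hnm hirr m hm (Or.inl hp7) χ hχ hχ1 hord ϖ r

end Summit.BirchSwinnertonDyer.BirchSwinnertonDyer.Theorems.EdixhovenFibreFiveSevenTwistDegreeStepOrdinary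

end
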